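import Summits.NavierStokesRegularity.NavierStokesRegularity.Theorems.ScenarioCensusAgeingMeterVertex
import Summits.NavierStokesRegularity.NavierStokesRegularity.Theorems.ScenarioCensusSilenceMeterRows
import HarnessLib

/-!
# AGEING METER port, part 5/5: §F″ (REV 3) TWO VERTICES — a non-trivial element recurs about AT MOST ONE space-time vertex per factor (`vertexMap`, `Row_A2ag2v`, `row_A2ag2v`,
# `row_A2ag2v_sameLag`, controls); §H the rung decides every row; census KEYS

Re-homed for the scenario census (typer seat ns-census-typer-1 g10; the cells A2agT / A2agV / A2ag0 / A2agU / A2agFf / A2ag2v are MEMBERS OF RECORD «DECIDED IN KERNEL IN FILES» of row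
A2 (item 77: REV 1 critic PASS tier B, REV 3 idea-crit-3 g10 ROW WORDS BY KEY 11:55:14Z; ref PRE-CHECK ✓ §18.27 / §18.37; lead label), A2agF OPEN ≡ D7; this port makes the decided
cells TREE-decided): VERBATIM PORT of ns-idea-2 LINE g17-2 «ageing-meter» REV 3, `pub/ideators/ns-idea-2/lines/ageing-meter/line-ageing-meter.rev3.lean` sha16 a9c9c668d639c4c6
(1173 l., lean check rc 0, 0 sorry), split for the 400-line rule into `ScenarioCensusAgeingMeter` (§A–§C) → `…AgeingMeterLaw` (§D–§E) → `…AgeingMeterRows` (§F–§G) →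
`…AgeingMeterVertex` (§F′) → `…AgeingMeterTwoVertex` (§F″, §H + census KEYS).  Lean text VERBATIM in namespace `…Theorems.ScenarioCensus.AgeingMeter` (the line's
`…Lines.AgeingMeter` re-homed); port edits: the line's `local notation "E3"` is spelled as the reducible `abbrev E3` of every census file; declarations the line restates VERBATIM
from the landed SILENCE METER (`simBall`, `simBall_neg_one`, `smul_mem_simBall`, `e₀`, `norm_e₀`) and HULL METER (`pastPart`, `pastPart_of_neg`, `pastPart_of_not_neg`,
`isTypeIAncientMild_pastPart`, `isDiscretelySelfSimilar_pastPart`, `PastInvariant`, `PastLiouville`) ports are taken BY NAME (gate lint dedup.landed); `set_option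
linter.unusedVariables false` dropped (binders the linter names are `_`-prefixed); `@[conjecture]` on the OPEN row `Row_A2agF` (≡ census D7); one-line docstrings added where missing
(gate lint).  Statements untouched.

No census VALUE is moved here (row A2 stays OPEN-WITH-LINE; the members become TREE-decided by name); D7 / (L′) are NOT proved; no summit statement is proved by this file. Lemmas that restate already-landed tree declarations are taken BY NAME (gate lint `dedup.landed`): `simBall` = `SilenceMeter.simBall`, `smul_mem_simBall` = `SilenceMeter.smul_mem_simBall`, `e₀` = `SilenceMeter.e₀`, `pastPart` = `HullMeter.pastPart`, `isTypeIAncientMild_pastPart` = `HullMeter.isTypeIAncientMild_pastPart`, `isDiscretelySelfSimilar_pastPart` = `HullMeter.isDiscretelySelfSimilar_pastPart`, `PastInvariant` = `HullMeter.PastInvariant`, `PastLiouville` = `HullMeter.PastLiouville`.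
-/

-- the summit and its single problem share the name `NavierStokesRegularity` (D-0017 nested layout)
set_option linter.dupNamespace false

noncomputable section

open Set Function Filter Metric
open scoped Topology
open Literature.Analysis Literature.Analysis.FluidPDE
open Summit.NavierStokesRegularity.NavierStokesRegularity.Theorems
open Summit.NavierStokesRegularity.NavierStokesRegularity.Theorems.ScenarioCensus.ScrewBlowdown
open Summit.NavierStokesRegularity.NavierStokesRegularity.Theorems.NearExtremalTransiencePerFlow.FilamentSelection
open Summit.NavierStokesRegularity.NavierStokesRegularity.Cruxes.ScarEnvelopeTypeI.AxisActivity

namespace Summit.NavierStokesRegularity.NavierStokesRegularity.Theorems.ScenarioCensus.AgeingMeter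

variable {C : ℝ} {u : ℝ → E3 → E3}

/-! ## F″. (REV 3) TWO VERTICES — a non-trivial element recurs about AT MOST ONE space-time vertex per factor

REV 2 placed the single future vertex: `Row_A2agF` = apex-DSS Liouville at the same factor = census D7 (OPEN).  REV 3 moves
the vertex: the CENTRED vertex map `vertexMap λ δ ξ u (t,x) = λ • u(λ²(t − δ), ξ + λ(x − ξ))` (zoom by `λ` about the spatial
centre `ξ`, then the lag `δ ≥ 0`; space-time vertex `(λ²δ/(λ²−1), ξ)`; `ξ = 0` is REV 1/2's map, `δ = 0` is DSS about `ξ`).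
If ONE germ of ONE slice recurs under TWO vertex maps with a COMMON factor `λ ≠ 1` and DISTINCT data `(ξ₁, δ₁) ≠ (ξ₂, δ₂)`,
then `u ≡ 0` — for EVERY `λ > 0`, coarse included (`eq_zero_of_twoVertex`, row `Row_A2ag2v`, DECIDED).  Mechanism (finite
model = the affine space-time actions): both recurrences globalise (`germRigidity`, the centred vertex map preserves the class);
the «quotient» of the two maps acts on space-time as a DRIFT `(t, x) ↦ (t − (δ₁ − δ₂), x + a)`, `λ • a = (1 − λ)(ξ₁ − ξ₂)`:
equal lags ⇒ a pure translation `a ≠ 0` at every past time ⇒ census A13 (`periodic_typeI_liouville_genuine`, BY NAME);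
unequal lags ⇒ REV 1's DRIFT LAW (`eq_zero_of_comotionRecurrent`, `L = 1`).  CONTRAST, kernel-checked on both sides:
ONE future vertex (λ > 1, δ > 0) = `Row_A2agF` = D7, OPEN; TWO future vertices with the same λ = DECIDED; and the open cell is
DISJOINT from the DSS class at its own factor (`futureVertex_not_dss`). -/

/-- The CENTRED VERTEX MAP: zoom by `l` about the spatial centre `ξ`, then the lag `δ`. -/
def vertexMap (l δ : ℝ) (ξ : E3) (u : ℝ → E3 → E3) : ℝ → E3 → E3 :=
  fun t x => l • u (l ^ 2 * (t - δ)) (ξ + l • (x - ξ))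

/-- The vertex map, unfolded. -/
theorem vertexMap_apply (l δ : ℝ) (ξ : E3) (u : ℝ → E3 → E3) (t : ℝ) (x : E3) :
    vertexMap l δ ξ u t x = l • u (l ^ 2 * (t - δ)) (ξ + l • (x - ξ)) := rfl

/-- About the origin it is the vertex map of REV 1/2 (`Row_A2agV`, `Row_A2agF`). -/
theorem vertexMap_zero (l δ : ℝ) (u : ℝ → E3 → E3) (t : ℝ) (x : E3) :
    vertexMap l δ 0 u t x = l • u (l ^ 2 * (t - δ)) (l • x) := by
  rw [vertexMap_apply, zero_add, sub_zero]

/-- With zero lag it is the parabolic dilation about `ξ` (DSS about the centre `ξ` when it fixes `u`). -/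
theorem vertexMap_lag_zero (l : ℝ) (ξ : E3) (u : ℝ → E3 → E3) (t : ℝ) (x : E3) :
    vertexMap l 0 ξ u t x = l • u (l ^ 2 * t) (ξ + l • (x - ξ)) := by
  rw [vertexMap_apply, sub_zero]

/-- The centred vertex map PRESERVES THE CLASS (`l > 0`, `δ ≥ 0`): lag (`comp_sub_right`) ∘ translate (`comp_add_right`) ∘
zoom (`zoom_isTypeIAncientMild`) ∘ translate back. -/
theorem isTypeIAncientMild_vertexMap (hu : IsTypeIAncientMild C u) {l : ℝ} (hl : 0 < l) {δ : ℝ} (hδ : 0 ≤ δ) (ξ : E3) :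
    IsTypeIAncientMild C (vertexMap l δ ξ u) := by
  have h1 : IsTypeIAncientMild C (nsRescale l (fun s y => u (s - l ^ 2 * δ) (y + ξ))) :=
    zoom_isTypeIAncientMild ((hu.comp_sub_right (by positivity)).comp_add_right ξ) hl
  have h2 := h1.comp_add_right (-ξ)
  have e : vertexMap l δ ξ u = fun τ x => nsRescale l (fun s y => u (s - l ^ 2 * δ) (y + ξ)) τ (x + -ξ) := by
    funext t x
    rw [vertexMap_apply, nsRescale_apply, ← sub_eq_add_neg, mul_sub, add_comm (l • (x - ξ)) ξ]
  rw [e]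
  exact h2

/-- GERM ⇒ GLOBAL for a centred vertex recurrence (`germRigidity`). -/
theorem ctrVertexRecurrent_global (hu : IsTypeIAncientMild C u) {l : ℝ} (hl : 0 < l) {δ : ℝ} (hδ : 0 ≤ δ) (ξ : E3)
    {t₀ : ℝ} (ht₀ : t₀ < 0) {U : Set E3} (hU : IsOpen U) (hne : U.Nonempty)
    (heq : ∀ x ∈ U, vertexMap l δ ξ u t₀ x = u t₀ x) : ∀ t < 0, ∀ x, vertexMap l δ ξ u t x = u t x :=
  fun _ ht x => germRigidity (isTypeIAncientMild_vertexMap hu hl hδ ξ) hu ht₀ hU hne heq ht x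

/-- THE DRIFT VECTOR of a pair of vertex maps with common factor: `l • a = (1 − l) • (ξ₁ − ξ₂)`. -/
def driftVec (l : ℝ) (ξ₁ ξ₂ : E3) : E3 := l⁻¹ • ((1 - l) • (ξ₁ - ξ₂))

/-- Scaling the drift vector. -/
theorem smul_driftVec {l : ℝ} (hl : l ≠ 0) (ξ₁ ξ₂ : E3) : l • driftVec l ξ₁ ξ₂ = (1 - l) • (ξ₁ - ξ₂) := by
  rw [driftVec, smul_smul, mul_inv_cancel₀ hl, one_smul]

/-- The drift vector is nonzero. -/
theorem driftVec_ne_zero {l : ℝ} (hl : l ≠ 0) (hl1 : l ≠ 1) {ξ₁ ξ₂ : E3} (hξ : ξ₁ ≠ ξ₂) : driftVec l ξ₁ ξ₂ ≠ 0 := by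
  intro h
  have h' : (1 - l) • (ξ₁ - ξ₂) = 0 := by rw [← smul_driftVec hl, h, smul_zero]
  rcases smul_eq_zero.1 h' with h1 | h1
  · exact hl1 (by linarith)
  · exact hξ (sub_eq_zero.1 h1)

/-- **KEY IDENTITY (the quotient of two vertex maps is a drift).**  If `u` is fixed by the vertex maps at `(l, δ₁, ξ₁)` and
`(l, δ₂, ξ₂)` (common factor), then its slices are drift-related: `u(t, x) = u(t − δ₁ + δ₂, x + a)`, `a = driftVec l ξ₁ ξ₂`. -/
theorem drift_of_twoVertex {l : ℝ} (hl : 0 < l) {δ₁ δ₂ : ℝ} {ξ₁ ξ₂ : E3}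
    (h₁ : ∀ t < (0 : ℝ), ∀ x, vertexMap l δ₁ ξ₁ u t x = u t x) (h₂ : ∀ t < (0 : ℝ), ∀ x, vertexMap l δ₂ ξ₂ u t x = u t x)
    {t : ℝ} (ht : t < 0) (ht' : t - δ₁ + δ₂ < 0) (x : E3) :
    u t x = u (t - δ₁ + δ₂) (x + driftVec l ξ₁ ξ₂) := by
  rw [← h₁ t ht x, ← h₂ _ ht' _, vertexMap_apply, vertexMap_apply]
  congr 2
  · ring
  · rw [smul_sub, smul_sub, smul_add, smul_driftVec hl.ne', sub_smul, one_smul, smul_sub]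
    abel

/-- Unequal lags: the quotient is a genuine DRIFT (lag `δ₁ − δ₂ > 0`, translation `a`) — REV 1's drift law kills. -/
theorem eq_zero_of_twoVertex_lt (hu : IsTypeIAncientMild C u) {l : ℝ} (hl : 0 < l) {δ₁ δ₂ : ℝ} (hlt : δ₂ < δ₁)
    {ξ₁ ξ₂ : E3} (h₁ : ∀ t < (0 : ℝ), ∀ x, vertexMap l δ₁ ξ₁ u t x = u t x)
    (h₂ : ∀ t < (0 : ℝ), ∀ x, vertexMap l δ₂ ξ₂ u t x = u t x) : ∀ t < 0, ∀ x, u t x = 0 := by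
  refine eq_zero_of_comotionRecurrent hu (LinearIsometryEquiv.refl ℝ _) (driftVec l ξ₁ ξ₂) (sub_pos.2 hlt)
    (t₀ := -1) (by norm_num) isOpen_univ univ_nonempty fun x _ => ?_
  show u (-1 - (δ₁ - δ₂)) (x + driftVec l ξ₁ ξ₂) = u (-1) x
  rw [show (-1 : ℝ) - (δ₁ - δ₂) = -1 - δ₁ + δ₂ by ring]
  exact (drift_of_twoVertex hl h₁ h₂ (by norm_num) (by linarith) x).symm

/-- Equal lags, distinct centres: the quotient is the TRANSLATION `a ≠ 0` at every past time — census A13 kills. -/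
theorem eq_zero_of_twoVertex_eq (hu : IsTypeIAncientMild C u) {l : ℝ} (hl : 0 < l) (hl1 : l ≠ 1) {δ : ℝ}
    {ξ₁ ξ₂ : E3} (hξ : ξ₁ ≠ ξ₂) (h₁ : ∀ t < (0 : ℝ), ∀ x, vertexMap l δ ξ₁ u t x = u t x)
    (h₂ : ∀ t < (0 : ℝ), ∀ x, vertexMap l δ ξ₂ u t x = u t x) : ∀ t < 0, ∀ x, u t x = 0 := by
  refine ScenarioCensus.PeriodicGauge.periodic_typeI_liouville_genuine C u hu (driftVec l ξ₁ ξ₂) (driftVec_ne_zero hl.ne' hl1 hξ) fun t ht x => ?_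
  have h := drift_of_twoVertex hl h₁ h₂ ht (by linarith) x
  rw [sub_add_cancel] at h
  exact h.symm

/-- **TWO-VERTEX RIGIDITY (every factor `λ > 0`, `λ ≠ 1`, coarse included).**  If one germ of one slice of `u ∈ A_C` recurs
under TWO centred vertex maps with a COMMON factor and DISTINCT data `(ξ₁, δ₁) ≠ (ξ₂, δ₂)` (`δᵢ ≥ 0`), then `u ≡ 0` on the past. -/
theorem eq_zero_of_twoVertex (hu : IsTypeIAncientMild C u) {l : ℝ} (hl : 0 < l) (hl1 : l ≠ 1) {δ₁ δ₂ : ℝ}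
    (hδ₁ : 0 ≤ δ₁) (hδ₂ : 0 ≤ δ₂) {ξ₁ ξ₂ : E3} (hne : (ξ₁, δ₁) ≠ (ξ₂, δ₂)) {t₀ : ℝ} (ht₀ : t₀ < 0) {U : Set E3}
    (hU : IsOpen U) (hU' : U.Nonempty) (h₁ : ∀ x ∈ U, vertexMap l δ₁ ξ₁ u t₀ x = u t₀ x)
    (h₂ : ∀ x ∈ U, vertexMap l δ₂ ξ₂ u t₀ x = u t₀ x) : ∀ t < 0, ∀ x, u t x = 0 := by
  have g₁ := ctrVertexRecurrent_global hu hl hδ₁ ξ₁ ht₀ hU hU' h₁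
  have g₂ := ctrVertexRecurrent_global hu hl hδ₂ ξ₂ ht₀ hU hU' h₂
  rcases lt_trichotomy δ₁ δ₂ with hlt | heq | hgt
  · exact eq_zero_of_twoVertex_lt hu hl hlt g₂ g₁
  · subst heq
    have hξ : ξ₁ ≠ ξ₂ := fun h => hne (by rw [h])
    exact eq_zero_of_twoVertex_eq hu hl hl1 hξ g₁ g₂
  · exact eq_zero_of_twoVertex_lt hu hl hgt g₁ g₂

/-- **Reading 1 (two FUTURE vertices, decided — vs ONE future vertex = `Row_A2agF` = D7, open).** -/
theorem twoFutureVertex_decided (hu : IsTypeIAncientMild C u) {l : ℝ} (hl : 1 < l) {δ₁ δ₂ : ℝ} (hδ₁ : 0 < δ₁)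
    (hδ₂ : 0 < δ₂) {ξ₁ ξ₂ : E3} (hne : (ξ₁, δ₁) ≠ (ξ₂, δ₂)) {t₀ : ℝ} (ht₀ : t₀ < 0) {U : Set E3} (hU : IsOpen U)
    (hU' : U.Nonempty) (h₁ : ∀ x ∈ U, vertexMap l δ₁ ξ₁ u t₀ x = u t₀ x) (h₂ : ∀ x ∈ U, vertexMap l δ₂ ξ₂ u t₀ x = u t₀ x) :
    ∀ t < 0, ∀ x, u t x = 0 :=
  eq_zero_of_twoVertex hu (one_pos.trans hl) (ne_of_gt hl) hδ₁.le hδ₂.le hne ht₀ hU hU' h₁ h₂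

/-- **Reading 2 (the open cell is DISJOINT from the DSS class at its own factor).**  A future-vertex recurrent element
(`λ > 1`, `δ > 0`, any centre) which is ALSO `λ`-DSS about ANY centre `ξ'` on a germ (lag `0`) vanishes: the open cell `Row_A2agF`
contains the time-ADVANCED coarse DSS elements (REV 2) but NO DSS element at the same factor. -/
theorem futureVertex_not_dss (hu : IsTypeIAncientMild C u) {l : ℝ} (hl : 1 < l) {δ : ℝ} (hδ : 0 < δ) {ξ ξ' : E3}
    {t₀ : ℝ} (ht₀ : t₀ < 0) {U : Set E3} (hU : IsOpen U) (hU' : U.Nonempty)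
    (hF : ∀ x ∈ U, vertexMap l δ ξ u t₀ x = u t₀ x) (hD : ∀ x ∈ U, vertexMap l 0 ξ' u t₀ x = u t₀ x) :
    ∀ t < 0, ∀ x, u t x = 0 :=
  eq_zero_of_twoVertex hu (one_pos.trans hl) (ne_of_gt hl) hδ.le le_rfl
    (fun h => hδ.ne' (by simpa using congrArg Prod.snd h)) ht₀ hU hU' hF hD

/-- **Reading 3 (AT MOST ONE VERTEX PER FACTOR).**  For a non-trivial `u ∈ A_C` and a factor `λ ≠ 1`, the set of vertex data
`(ξ, δ)`, `δ ≥ 0`, whose centred vertex map fixes a given germ is a subsingleton. -/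
theorem atMostOneVertex_of_nontrivial (hu : IsTypeIAncientMild C u) (hne : ∃ t < (0 : ℝ), ∃ x, u t x ≠ 0) {l : ℝ}
    (hl : 0 < l) (hl1 : l ≠ 1) {t₀ : ℝ} (ht₀ : t₀ < 0) {U : Set E3} (hU : IsOpen U) (hU' : U.Nonempty) :
    Set.Subsingleton {p : E3 × ℝ | 0 ≤ p.2 ∧ ∀ x ∈ U, vertexMap l p.2 p.1 u t₀ x = u t₀ x} := by
  intro p hp q hq
  by_contra hpq
  obtain ⟨t, ht, x, hx⟩ := hne
  exact hx (eq_zero_of_twoVertex hu hl hl1 hp.1 hq.1 (fun h => hpq (Prod.ext (congrArg Prod.fst h) (congrArg Prod.snd h)))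
    ht₀ hU hU' hp.2 hq.2 t ht x)

/-- **Row A2ag2v** (TWO-VERTEX recurrence of a germ with a common factor `λ ≠ 1` and distinct data `(ξ₁, δ₁) ≠ (ξ₂, δ₂)`,
`δᵢ ≥ 0` ⇒ `u ≡ 0`).  DECIDED (`row_A2ag2v`).  Contrast: ONE future vertex = `Row_A2agF`, OPEN (= D7). -/
def Row_A2ag2v : Prop :=
  ∀ (C : ℝ) (u : ℝ → E3 → E3), IsTypeIAncientMild C u →
    (∃ l : ℝ, 0 < l ∧ l ≠ 1 ∧ ∃ δ₁ δ₂ : ℝ, 0 ≤ δ₁ ∧ 0 ≤ δ₂ ∧ ∃ ξ₁ ξ₂ : E3, (ξ₁, δ₁) ≠ (ξ₂, δ₂) ∧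
      ∃ t₀ < (0 : ℝ), ∃ U : Set E3, IsOpen U ∧ U.Nonempty ∧
        (∀ x ∈ U, vertexMap l δ₁ ξ₁ u t₀ x = u t₀ x) ∧ (∀ x ∈ U, vertexMap l δ₂ ξ₂ u t₀ x = u t₀ x)) →
    ∀ t < (0 : ℝ), ∀ x, u t x = 0

/-- **Row A2ag2v holds** (two vertices). -/
theorem row_A2ag2v : Row_A2ag2v := by
  rintro C u hu ⟨l, hl, hl1, δ₁, δ₂, hδ₁, hδ₂, ξ₁, ξ₂, hne, t₀, ht₀, U, hU, hU', h₁, h₂⟩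
  exact eq_zero_of_twoVertex hu hl hl1 hδ₁ hδ₂ hne ht₀ hU hU' h₁ h₂

/-- Nesting: the two-vertex row CONTAINS REV 1's interior-vertex row?  No — one interior vertex is already decided
(`Row_A2agV`) and is not a two-vertex cell; but the two-vertex row does contain the DRIFT row at `L = 1` in disguise: a drift
`u(t, x) = u(t − Δ, x + a)` is the quotient of two vertex maps.  Recorded instead: the open single-vertex row implies nothing here,
and the two-vertex row at `λ > 1`, `δ₁ = δ₂ > 0` is exactly the «second centre» upgrade of `Row_A2agF`. -/
theorem row_A2ag2v_sameLag (h : Row_A2ag2v) (C : ℝ) (u : ℝ → E3 → E3) (hu : IsTypeIAncientMild C u) {l : ℝ}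
    (hl : 1 < l) {δ : ℝ} (hδ : 0 < δ) {ξ₁ ξ₂ : E3} (hξ : ξ₁ ≠ ξ₂) {t₀ : ℝ} (ht₀ : t₀ < 0) {U : Set E3} (hU : IsOpen U)
    (hU' : U.Nonempty) (h₁ : ∀ x ∈ U, vertexMap l δ ξ₁ u t₀ x = u t₀ x) (h₂ : ∀ x ∈ U, vertexMap l δ ξ₂ u t₀ x = u t₀ x) :
    ∀ t < 0, ∀ x, u t x = 0 :=
  h C u hu ⟨l, one_pos.trans hl, ne_of_gt hl, δ, δ, hδ.le, hδ.le, ξ₁, ξ₂, fun e => hξ (congrArg Prod.fst e), t₀, ht₀, U, hU,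
    hU', h₁, h₂⟩

/-! ### F″.1 Controls for the two-vertex row -/

/-- The space-independent VERTEX BURST of REV 1 (`vertexBurst λ δ`, nonzero, exploding at the vertex) recurs under the centred
vertex map about EVERY centre `ξ` with the same `(λ, δ)`: the two-vertex recurrence with `ξ₁ ≠ ξ₂`, `δ₁ = δ₂` is KINEMATICALLY
SATISFIABLE by a nonzero field — what kills in `Row_A2ag2v` is membership in the class (mildness), as for the drift law. -/
theorem vertexBurst_recurs_ctr {l δ : ℝ} (hl : 0 < l) (hl1 : l ≠ 1) (ξ : E3) (t : ℝ) (x : E3) :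
    vertexMap l δ ξ (vertexBurst l δ) t x = vertexBurst l δ t x :=
  vertexBurst_recurs hl hl1 t x

/-- The zero field recurs about every vertex. -/
theorem vertexMap_zero_field (l δ : ℝ) (ξ : E3) (t : ℝ) (x : E3) :
    vertexMap l δ ξ (fun _ _ => (0 : E3)) t x = 0 := by
  simp [vertexMap]

/-- With factor `λ = 1` the centred vertex map forgets its centre (`vertexMap 1 δ ξ u (t,x) = u(t − δ, x)`): two «distinct»
data `(ξ₁, δ) ≠ (ξ₂, δ)` give the SAME map — the reason `λ ≠ 1` is required in `Row_A2ag2v` (at `λ = 1`, `δ > 0` one map is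
REV 1's time-recurrence cell, decided on its own; at `λ = 1`, `δ = 0` it is the identity). -/
theorem vertexMap_one (δ : ℝ) (ξ : E3) (u : ℝ → E3 → E3) (t : ℝ) (x : E3) : vertexMap 1 δ ξ u t x = u (t - δ) x := by
  simp [vertexMap]

/-! ## H. The rung decides every row -/

/-- (L′) in the `IsTypeIAncientMild` form decides every row of this file. -/
theorem rows_of_L' (hL : ∀ (C : ℝ) (u : ℝ → E3 → E3), IsTypeIAncientMild C u → ∀ t < 0, ∀ x, u t x = 0) :
    Row_A2agT ∧ Row_A2agV ∧ Row_A2ag0 ∧ Row_A2agU ∧ Row_A2agF ∧ Row_A2agFf ∧ Row_A2ag2v := by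
  refine ⟨fun C u hu _ => hL C u hu, fun C u hu _ => hL C u hu, fun C u hu _ => hL C u hu, ?_,
    fun C u hu _ => hL C u hu, fun C => ⟨2, one_lt_two, fun u hu _ => hL C u hu⟩, fun C u hu _ => hL C u hu⟩
  intro C L b δ hδ η₀ ρ hρ
  exact ⟨1, one_pos, fun u hu _ => hL C u hu⟩

/-- **The rung decides every row**: the LADDER-NS rung (L′) `Theses.SymmetryModuliCount.TypeIAncientLiouville`
⟨stmt-NavierStokesRegularity-10661⟩, BY NAME, implies every row of the ageing meter (including the open
`Row_A2agF` and the REV 2 row `Row_A2agFf`).  Nothing here proves the rung. -/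
theorem rows_of_rung (hL : Theses.SymmetryModuliCount.TypeIAncientLiouville) :
    Row_A2agT ∧ Row_A2agV ∧ Row_A2ag0 ∧ Row_A2agU ∧ Row_A2agF ∧ Row_A2agFf ∧ Row_A2ag2v :=
  rows_of_L' fun C u hu => hL C u (isTypeIAncientMild_iff.1 hu)

end Summit.NavierStokesRegularity.NavierStokesRegularity.Theorems.ScenarioCensus.AgeingMeter

namespace Summit.NavierStokesRegularity.NavierStokesRegularity.Theorems.ScenarioCensus

/-! ## Census KEYS (ns `…Theorems.ScenarioCensus`): instrument AGEING METER (block A2) — TREE-decided cells A2agT / A2agV / A2ag0 / A2agU / A2agFf / A2ag2v, OPEN row A2agF (≡ D7) -/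

/-- **Cell A2agT** (EXACT recurrence of a germ of one slice after a lag `δ > 0` modulo a rigid co-motion ⇒ `u ≡ 0`): `:= AgeingMeter.Row_A2agT`. DECIDED. -/
def Row_A2agT : Prop := AgeingMeter.Row_A2agT
/-- A2agT is EXCLUDED (decided in the tree): `AgeingMeter.row_A2agT`. -/
theorem row_A2agT_excluded : Row_A2agT := AgeingMeter.row_A2agT

/-- **Cell A2agV** (recurrence about an INTERIOR vertex, factor `0 < l ≠ 1` ⇒ `u ≡ 0`): `:= AgeingMeter.Row_A2agV`. DECIDED. -/
def Row_A2agV : Prop := AgeingMeter.Row_A2agV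
/-- A2agV is EXCLUDED (decided in the tree): `AgeingMeter.row_A2agV`. -/
theorem row_A2agV_excluded : Row_A2agV := AgeingMeter.row_A2agV

/-- **Cell A2ag0** (ASYMPTOTIC recurrence along ONE receding similarity-ball sequence ⇒ `u ≡ 0`): `:= AgeingMeter.Row_A2ag0`. DECIDED. -/
def Row_A2ag0 : Prop := AgeingMeter.Row_A2ag0
/-- A2ag0 is EXCLUDED (decided in the tree): `AgeingMeter.row_A2ag0`. -/
theorem row_A2ag0_excluded : Row_A2ag0 := AgeingMeter.row_A2ag0

/-- **Cell A2agU** (the UNIVERSAL ageing floor `f(C, L, b, δ, η₀, ρ) > 0`): `:= AgeingMeter.Row_A2agU`. DECIDED. -/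
def Row_A2agU : Prop := AgeingMeter.Row_A2agU
/-- A2agU is EXCLUDED (decided in the tree): `AgeingMeter.row_A2agU`. -/
theorem row_A2agU_excluded : Row_A2agU := AgeingMeter.row_A2agU

/-- **Cell A2agFf** (REV 2 · FUTURE-VERTEX recurrence with a FINE factor `1 < l < c₁(C)` ⇒ `u ≡ 0`, via the tree's `NearOneRateDss`): `:= AgeingMeter.Row_A2agFf`. DECIDED. -/
def Row_A2agFf : Prop := AgeingMeter.Row_A2agFf
/-- A2agFf is EXCLUDED (decided in the tree): `AgeingMeter.row_A2agFf`. -/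
theorem row_A2agFf_excluded : Row_A2agFf := AgeingMeter.row_A2agFf

/-- **Cell A2ag2v** (REV 3 · recurrence about TWO distinct space-time vertices with one factor `0 < l ≠ 1` ⇒ `u ≡ 0`): `:= AgeingMeter.Row_A2ag2v`. DECIDED. -/
def Row_A2ag2v : Prop := AgeingMeter.Row_A2ag2v
/-- A2ag2v is EXCLUDED (decided in the tree): `AgeingMeter.row_A2ag2v`. -/
theorem row_A2ag2v_excluded : Row_A2ag2v := AgeingMeter.row_A2ag2v

/-- **Row A2agF** (future-vertex recurrence with a COARSE factor, any `l > 1`) — typed only, ≡ apex-DSS Liouville ≡ the coarse past Liouville theorem per factor (census D7; `AgeingMeter.row_A2agF_iff` / `row_A2agF_iff_coarsePastLiouville`): `:= AgeingMeter.Row_A2agF`. OPEN. -/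
@[conjecture] def Row_A2agF : Prop := AgeingMeter.Row_A2agF

/-- Lattice edge at key level: A2agU → A2ag0 (`AgeingMeter.row_A2ag0_of_row_A2agU`). -/
theorem row_A2ag0_of_row_A2agU : Row_A2agU → Row_A2ag0 := AgeingMeter.row_A2ag0_of_row_A2agU

end Summit.NavierStokesRegularity.NavierStokesRegularity.Theorems.ScenarioCensus

end
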